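import Literature.Computability.AlgebraicComplexity.ApproxDecompositionCertificate
import Literature.Barriers.MatrixMultiplication.UniversalMethodBarrierAsymptoticRank
import HarnessLib

/-!
# Integer certificates for degenerations `S ⊵ T` between arbitrary formats, checked by `decide`

Solo-informed seat (gen 25), support TOOL for the degeneration neighbourhood of the door tensor
`T_{cw,2}` (paper §2n).  Everything here is PROVED and format-generic; nothing is specific to one
tensor.  It is the two-tensor companion of `ApproxDecompositionCertificate.lean` (`ApproxCert`, which
certifies `⟨r⟩ ⊵_h T`, i.e. border-rank upper bounds): here the SOURCE is an arbitrary integer tensor.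

The object certified is Alman's algebraic degeneration of order `h`
(`Literature.Barriers.MatrixMultiplication.IsPolyDegen h s t A B C`, Alman 2021 §2.4 after
Strassen and Bini; Bürgisser–Clausen–Shokrollahi 1997, (15.19)–(15.20)): polynomial matrices
`A(ε) ∈ K[ε]^{a×a'}`, `B(ε) ∈ K[ε]^{b×b'}`, `C(ε) ∈ K[ε]^{c×c'}` with
`(A(ε) ⊗ B(ε) ⊗ C(ε)) · S = ε^h · T + O(ε^{h+1})`.  With INTEGER data the defining identities are
finitely many integer polynomial identities whose truncations to degree `≤ h` are a closed Boolean
computation: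

* `DegenCert.check a b c a' b' c' h D S T A B C` — for formats `a×b×c ⊵ a'×b'×c'`, integer tensors
  `S`, `T`, an integer multiplier `D` and coefficient lists `A i i', B j j', C l l' : List ℤ`
  (ascending in `ε`), checks that every entry `(i',j',l')` of the substituted tensor
  `Σ_{i,j,l} S_{ijl} A_{ii'}(ε) B_{jj'}(ε) C_{ll'}(ε)`, computed over `ℤ` modulo `ε^{h+1}`, reads
  `0, …, 0, D·T_{i'j'l'}` in degrees `0, …, h`;
* `DegenCert.isPolyDegen_of_check` — a successful check IS an order-`h` degeneration `S ⊵ D·T` over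
  every commutative ring `K`;
* `DegenCert.polyDegeneratesTo_of_check` — hence `S ⊵ T` (`PolyDegeneratesTo`) over every
  commutative ring in which `D` is a unit (rescale the first factor by `D⁻¹`), and
  `DegenCert.asymptoticRank_le_of_check` — `R̃(T) ≤ R̃(S)` over every field in which `D` is a unit
  (`asymptoticRank_le_of_polyDegeneratesTo`);
* sanity client: the classical degeneration `⟨2⟩ ⊵ W` of the unit tensor to the `W`-state
  `e₀e₀e₁ + e₀e₁e₀ + e₁e₀e₀` (order `1`), `DegenCert.unitTwo_degen_wState`.

The integer polynomial arithmetic (`Smirnov2013.toPoly/psmul/pmul/psum`, `ApproxCert.ptrunc/lowCheck`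
and their lemmas) is REUSED.  Certificates are FOUND outside Lean; only their verification is in the
kernel (`decide` / `decide +kernel` on literal data).

## References

* [Alman2021] J. Alman, *Limits on the Universal Method for matrix multiplication*, Theory of
  Computing 17 (2021), §2.4 (degeneration over `F[λ]`).
* [BurgisserClausenShokrollahi1997] P. Bürgisser, M. Clausen, M. A. Shokrollahi, *Algebraic
  Complexity Theory*, Springer 1997 — §15.4, (15.19)–(15.20) (degeneration), Lemma (15.27).
-/

noncomputable section

open scoped BigOperators Polynomial
open Polynomial

namespace Summit.MatrixMultiplication.MatrixMultiplication.Theorems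

open Literature.Computability.AlgebraicComplexity
open Literature.Computability.AlgebraicComplexity.Smirnov2013 (toPoly coeffL padd psmul pmul psum
  coeff_toPoly toPoly_padd toPoly_psmul toPoly_pmul toPoly_psum)
open Literature.Computability.AlgebraicComplexity.ApproxCert (ptrunc lowCheck coeffL_ptrunc
  coeff_toPoly_ptrunc coeff_mul_congr_of_lt coeffL_of_lowCheck)
open Literature.Barriers.MatrixMultiplication (polySubst IsPolyDegen PolyDegeneratesTo
  asymptoticRank_le_of_polyDegeneratesTo)

namespace DegenCert

/-! ## The certificate check -/

/-- The `(i',j',l')` entry `Σ_{i,j,l} S_{ijl} A_i(ε) B_j(ε) C_l(ε)` of the substituted tensor, computed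
over `ℤ` modulo `ε^n` (every product truncated), for the coefficient lists `A i = A_{ii'}(ε)`,
`B j = B_{jj'}(ε)`, `C l = C_{ll'}(ε)` at a fixed target entry. [cite: Alman2021, §2.4] -/
def entryPoly (n : ℕ) {a b c : ℕ} (S : Fin a → Fin b → Fin c → ℤ) (A : Fin a → List ℤ)
    (B : Fin b → List ℤ) (C : Fin c → List ℤ) : List ℤ :=
  psum (List.ofFn fun i : Fin a => ptrunc n (pmul (A i)
    (psum (List.ofFn fun j : Fin b => ptrunc n (pmul (B j)
      (psum (List.ofFn fun l : Fin c => psmul (S i j l) (C l))))))))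

/-- **The certificate check** for `(A(ε) ⊗ B(ε) ⊗ C(ε)) · S = ε^h · (D·T) + O(ε^{h+1})` with integer
data: for every target entry `(i',j',l')` the entry polynomial (computed modulo `ε^{h+1}`) has
coefficients `0, …, 0, D · T i' j' l'` in degrees `0, …, h`.  A closed Boolean computation over `ℤ`,
meant to be evaluated by `decide` / `decide +kernel`. [cite: Alman2021, §2.4] -/
def check (a b c a' b' c' h : ℕ) (D : ℤ) (S : Fin a → Fin b → Fin c → ℤ)
    (T : Fin a' → Fin b' → Fin c' → ℤ) (A : Fin a → Fin a' → List ℤ) (B : Fin b → Fin b' → List ℤ)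
    (C : Fin c → Fin c' → List ℤ) : Bool :=
  (List.finRange a').all fun i' => (List.finRange b').all fun j' => (List.finRange c').all fun l' =>
    lowCheck (entryPoly (h + 1) S (fun i => A i i') (fun j => B j j') (fun l => C l l')) h
      (D * T i' j' l')

/-- Unpacking a successful check: entry by entry, degree by degree. [cite: Alman2021, §2.4] -/
theorem coeffL_entryPoly_of_check {a b c a' b' c' h : ℕ} {D : ℤ} {S : Fin a → Fin b → Fin c → ℤ}
    {T : Fin a' → Fin b' → Fin c' → ℤ} {A : Fin a → Fin a' → List ℤ} {B : Fin b → Fin b' → List ℤ}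
    {C : Fin c → Fin c' → List ℤ} (hc : check a b c a' b' c' h D S T A B C = true) (i' : Fin a')
    (j' : Fin b') (l' : Fin c') {d : ℕ} (hd : d ≤ h) :
    coeffL (entryPoly (h + 1) S (fun i => A i i') (fun j => B j j') (fun l => C l l')) d =
      if d = h then D * T i' j' l' else 0 := by
  simp only [check, List.all_eq_true] at hc
  exact coeffL_of_lowCheck _ _ _
    (hc i' (List.mem_finRange i') j' (List.mem_finRange j') l' (List.mem_finRange l')) d hd

/-! ## Soundness -/

section Sound

variable (K : Type*) [CommRing K]

/-- `toPoly` of a `psum` over `List.ofFn` is the `Finset` sum. [folklore] -/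
theorem toPoly_psum_ofFn {m : ℕ} (f : Fin m → List ℤ) :
    (toPoly (psum (List.ofFn f)) : K[X]) = ∑ i, (toPoly (f i) : K[X]) := by
  rw [toPoly_psum, List.map_ofFn, List.sum_ofFn]
  rfl

/-- The innermost sum is exact: `Σ_l S_{ijl} · C_l(ε)`. [folklore] -/
theorem toPoly_inner {c : ℕ} (s : Fin c → ℤ) (C : Fin c → List ℤ) :
    (toPoly (psum (List.ofFn fun l : Fin c => psmul (s l) (C l))) : K[X]) =
      ∑ l, Polynomial.C ((s l : ℤ) : K) * toPoly (C l) := by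
  rw [toPoly_psum_ofFn]
  exact Finset.sum_congr rfl fun l _ => toPoly_psmul _ _

/-- The middle sum, computed modulo `ε^n`, has below degree `n` the coefficients of
`Σ_j B_j(ε) · Σ_l S_{ijl} C_l(ε)`. [folklore] -/
theorem coeff_toPoly_middle (n : ℕ) {b c : ℕ} (s : Fin b → Fin c → ℤ) (B : Fin b → List ℤ)
    (C : Fin c → List ℤ) (d : ℕ) (hd : d < n) :
    (toPoly (psum (List.ofFn fun j : Fin b => ptrunc n (pmul (B j)
      (psum (List.ofFn fun l : Fin c => psmul (s j l) (C l)))))) : K[X]).coeff d =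
      (∑ j, toPoly (B j) * ∑ l, Polynomial.C ((s j l : ℤ) : K) * toPoly (C l)).coeff d := by
  rw [toPoly_psum_ofFn, finsetSum_coeff, finsetSum_coeff]
  refine Finset.sum_congr rfl fun j _ => ?_
  rw [coeff_toPoly_ptrunc n _ d hd, toPoly_pmul, toPoly_inner]

/-- The entry polynomial computed modulo `ε^n` has, below degree `n`, the coefficients of the true
entry `Σ_i A_i(ε) · Σ_j B_j(ε) · Σ_l S_{ijl} C_l(ε) ∈ K[ε]`. [folklore] -/
theorem coeff_toPoly_entryPoly (n : ℕ) {a b c : ℕ} (S : Fin a → Fin b → Fin c → ℤ)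
    (A : Fin a → List ℤ) (B : Fin b → List ℤ) (C : Fin c → List ℤ) (d : ℕ) (hd : d < n) :
    (toPoly (entryPoly n S A B C) : K[X]).coeff d =
      (∑ i, toPoly (A i) * ∑ j, toPoly (B j) *
        ∑ l, Polynomial.C ((S i j l : ℤ) : K) * toPoly (C l)).coeff d := by
  rw [entryPoly, toPoly_psum_ofFn, finsetSum_coeff, finsetSum_coeff]
  refine Finset.sum_congr rfl fun i _ => ?_
  rw [coeff_toPoly_ptrunc n _ d hd, toPoly_pmul]
  exact coeff_mul_congr_of_lt (n := n) (fun _ _ => rfl)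
    (fun d' hd' => coeff_toPoly_middle K n (S i) B C d' hd') d hd

/-- The true entry is Alman's substituted tensor `polySubst`. [cite: Alman2021, §2.4] -/
theorem polySubst_eq_sum {a b c a' b' c' : ℕ} (S : Fin a → Fin b → Fin c → ℤ)
    (A : Fin a → Fin a' → List ℤ) (B : Fin b → Fin b' → List ℤ) (C : Fin c → Fin c' → List ℤ)
    (i' : Fin a') (j' : Fin b') (l' : Fin c') :
    polySubst (fun i j l => ((S i j l : ℤ) : K)) (fun i i' => (toPoly (A i i') : K[X]))
        (fun j j' => toPoly (B j j')) (fun l l' => toPoly (C l l')) i' j' l' =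
      ∑ i, toPoly (A i i') * ∑ j, toPoly (B j j') *
        ∑ l, Polynomial.C ((S i j l : ℤ) : K) * toPoly (C l l') := by
  simp only [polySubst, Finset.mul_sum]
  exact Finset.sum_congr rfl fun i _ => Finset.sum_congr rfl fun j _ =>
    Finset.sum_congr rfl fun l _ => by ring

variable {K}

/-- **Soundness.** A successful check is an order-`h` degeneration `S ⊵_h D·T` over `K[ε]`, for
every commutative ring `K`. [cite: Alman2021, §2.4] -/
theorem isPolyDegen_of_check {a b c a' b' c' h : ℕ} {D : ℤ} {S : Fin a → Fin b → Fin c → ℤ}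
    {T : Fin a' → Fin b' → Fin c' → ℤ} {A : Fin a → Fin a' → List ℤ} {B : Fin b → Fin b' → List ℤ}
    {C : Fin c → Fin c' → List ℤ} (hc : check a b c a' b' c' h D S T A B C = true) :
    IsPolyDegen h (fun i j l => ((S i j l : ℤ) : K)) (fun i' j' l' => ((D * T i' j' l' : ℤ) : K))
      (fun i i' => toPoly (A i i')) (fun j j' => toPoly (B j j')) (fun l l' => toPoly (C l l')) := by
  intro i' j' l' d hd
  rw [polySubst_eq_sum, ← coeff_toPoly_entryPoly K (h + 1) S (fun i => A i i') (fun j => B j j')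
    (fun l => C l l') d (by omega), coeff_toPoly, coeffL_entryPoly_of_check hc i' j' l' hd]
  split_ifs <;> simp

/-- Rescaling: an order-`h` degeneration `s ⊵_h d·t` with `d` a unit of `K` gives `s ⊵ t` (multiply
the first family of polynomials by `d⁻¹`). [cite: BurgisserClausenShokrollahi1997, (15.20)] -/
theorem polyDegeneratesTo_of_isPolyDegen_mul {ι κ μ ι' κ' μ' : Type*} [Fintype ι] [Fintype κ]
    [Fintype μ] {h : ℕ} {s : ι → κ → μ → K} {t : ι' → κ' → μ' → K} {A : ι → ι' → K[X]}
    {B : κ → κ' → K[X]} {C : μ → μ' → K[X]} {d : K} (hd : IsUnit d)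
    (H : IsPolyDegen h s (fun a b c => d * t a b c) A B C) : PolyDegeneratesTo s t := by
  obtain ⟨e, he⟩ := hd.exists_left_inv
  refine ⟨h, fun a a' => Polynomial.C e * A a a', B, C, fun a' b' c' j hj => ?_⟩
  have hsum : (∑ a, ∑ b, ∑ c, Polynomial.C (s a b c) * (Polynomial.C e * A a a' * B b b' * C c c'))
      = Polynomial.C e * polySubst s A B C a' b' c' := by
    simp only [polySubst, Finset.mul_sum]
    exact Finset.sum_congr rfl fun a _ => Finset.sum_congr rfl fun b _ =>
      Finset.sum_congr rfl fun c _ => by ring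
  rw [hsum, coeff_C_mul, H a' b' c' j hj]
  split_ifs
  · rw [← mul_assoc, he, one_mul]
  · rw [mul_zero]

/-- **`S ⊵ T`** from a checked certificate, over every commutative ring in which the multiplier `D`
is a unit. [cite: Alman2021, §2.4] -/
theorem polyDegeneratesTo_of_check (K : Type*) [CommRing K] {a b c a' b' c' h : ℕ} {D : ℤ}
    {S : Fin a → Fin b → Fin c → ℤ} {T : Fin a' → Fin b' → Fin c' → ℤ}
    {A : Fin a → Fin a' → List ℤ} {B : Fin b → Fin b' → List ℤ} {C : Fin c → Fin c' → List ℤ}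
    (hc : check a b c a' b' c' h D S T A B C = true) (hD : IsUnit (D : K)) :
    PolyDegeneratesTo (fun i j l => ((S i j l : ℤ) : K)) (fun i' j' l' => ((T i' j' l' : ℤ) : K)) := by
  have H := isPolyDegen_of_check (K := K) hc
  simp only [Int.cast_mul] at H
  exact polyDegeneratesTo_of_isPolyDegen_mul hD H

/-- **`S ⊵ T` over EVERY commutative ring** from a checked certificate with multiplier `D = 1`.
[cite: Alman2021, §2.4] -/
theorem polyDegeneratesTo_of_check_one (K : Type*) [CommRing K] {a b c a' b' c' h : ℕ}
    {S : Fin a → Fin b → Fin c → ℤ} {T : Fin a' → Fin b' → Fin c' → ℤ}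
    {A : Fin a → Fin a' → List ℤ} {B : Fin b → Fin b' → List ℤ} {C : Fin c → Fin c' → List ℤ}
    (hc : check a b c a' b' c' h 1 S T A B C = true) :
    PolyDegeneratesTo (fun i j l => ((S i j l : ℤ) : K)) (fun i' j' l' => ((T i' j' l' : ℤ) : K)) :=
  polyDegeneratesTo_of_check K hc (by simp)

/-- **`R̃(T) ≤ R̃(S)`** from a checked certificate, over every field in which `D` is a unit
(degeneration cannot increase asymptotic rank). [cite: Alman2021, §2.4] -/
theorem asymptoticRank_le_of_check (K : Type*) [Field K] {a b c a' b' c' h : ℕ} {D : ℤ}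
    {S : Fin a → Fin b → Fin c → ℤ} {T : Fin a' → Fin b' → Fin c' → ℤ}
    {A : Fin a → Fin a' → List ℤ} {B : Fin b → Fin b' → List ℤ} {C : Fin c → Fin c' → List ℤ}
    (hc : check a b c a' b' c' h D S T A B C = true) (hD : IsUnit (D : K)) :
    asymptoticRank (fun i' j' l' => ((T i' j' l' : ℤ) : K)) ≤
      asymptoticRank (fun i j l => ((S i j l : ℤ) : K)) :=
  asymptoticRank_le_of_polyDegeneratesTo (polyDegeneratesTo_of_check K hc hD)

end Sound

/-! ## Sanity client: `⟨2⟩ ⊵ W` -/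

/-- The unit tensor `⟨2⟩ = e₀e₀e₀ + e₁e₁e₁` as an integer tensor. [folklore] -/
def unitTwoInt : Fin 2 → Fin 2 → Fin 2 → ℤ :=
  ApproxCert.ofEntries 2 2 2 [((0, 0, 0), 1), ((1, 1, 1), 1)]

/-- The `W`-state `e₀e₀e₁ + e₀e₁e₀ + e₁e₀e₀` (a tensor of rank `3` and border rank `2`) as an
integer tensor. [folklore] -/
def wStateInt : Fin 2 → Fin 2 → Fin 2 → ℤ :=
  ApproxCert.ofEntries 2 2 2 [((0, 0, 1), 1), ((0, 1, 0), 1), ((1, 0, 0), 1)]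

/-- The classical order-`1` degeneration `⟨2⟩ ⊵ W`:
`(x₀+εx₁)(y₀+εy₁)(z₀+εz₁) − x₀y₀z₀ = ε·W + O(ε²)`, i.e. `e₀ ↦ (x₀+εx₁, y₀+εy₁, z₀+εz₁)`,
`e₁ ↦ (−x₀, y₀, z₀)`. [cite: BurgisserClausenShokrollahi1997, (15.20)] -/
theorem unitTwo_wState_check :
    check 2 2 2 2 2 2 1 1 unitTwoInt wStateInt ![![[1], [0, 1]], ![[-1], []]]
      ![![[1], [0, 1]], ![[1], []]] ![![[1], [0, 1]], ![[1], []]] = true := by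
  decide +kernel

/-- **`⟨2⟩ ⊵ W`** over every commutative ring. [cite: BurgisserClausenShokrollahi1997, (15.20)] -/
theorem unitTwo_degen_wState (K : Type*) [CommRing K] :
    PolyDegeneratesTo (fun i j l => ((unitTwoInt i j l : ℤ) : K))
      (fun i j l => ((wStateInt i j l : ℤ) : K)) :=
  polyDegeneratesTo_of_check_one K unitTwo_wState_check

end DegenCert

end Summit.MatrixMultiplication.MatrixMultiplication.Theorems

end
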